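import Summits.BirchSwinnertonDyer.BirchSwinnertonDyer.Theorems.GenusKolyvaginAtTwoPowDvdShaCardAtTwoRTLocalKernelQuadratic
import Literature.NumberTheory.EllipticCurves.ArchimedeanLocalConditionTorsion
import HarnessLib

/-!
# Route `GenusKolyvaginAtTwo`, LINE 18 / LINE 19 (L_T stmt-BirchSwinnertonDyer-23242, L⁺_T stmt-23379), critic
# #179 price (1) «LOCUS OF DESCENDED CLASSES AT `p ∣ d_K`», consumable form: WHEN `W_{v,K} = 0` THE `K_w`-LOCAL
# CONDITION OF A CLASS OVER `ℚ` IS ITS `ℚ_v`-LOCAL CONDITION (torsor level and level `n`)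

Seat `bsd-line-gk2-p3` g16 (cell `bsd-f1-sign2`), `--supports stmt-BirchSwinnertonDyer-23242` (helper; closes
nothing).  THEOREMS ONLY (no definition, no named fact, no `sorry`); BSD is not proved by any of this.

For an elliptic curve `E/ℚ`, a number field `K` and a finite place `w ∣ v`: a class `c ∈ H¹(ℚ, E)` whose
restriction to `K` is locally trivial at `w` — equivalently (`mem_localRestrictionKer_iff_resBaseChange_mem`) a
class dying in `H¹(K_w, E)` — maps, in `H¹(ℚ_v, E)`, into Matsuno's local kernel
`W_{v,K} = ker(H¹(ℚ_v, E) → H¹(K_w, E))` (`Matsuno2009.localKernel`).  So `W_{v,K} = 0` makes the two local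
conditions coincide:

* `localRestrictionKer_adicCompletion_eq_of_localKernel_eq_bot` — `W_{v,K} = 0` ⟹
  `ker(H¹(ℚ, E) → H¹(K_w, E)) = ker(H¹(ℚ, E) → H¹(ℚ_v, E))`;
  `mem_localRestrictionKer_adicCompletion_of_resBaseChange_mem` — the same read on `res_K c ∈ H¹(K, E_K)`;
  `selmerLocalKer_adicCompletion_eq_of_localKernel_eq_bot` — level `n`: the Selmer condition at `w` for a class
  of `H¹(ℚ, E[n])` (read in `H¹(K_w, E)`) IS the Selmer condition at `v`.
* `selmerLocalKer_adicCompletion_eq_of_finrank_eq_two_of_forall_two_smul` — combined with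
  `localKernel_eq_bot_of_finrank_eq_two_of_forall_two_smul` (this seat, `…LocalKernelQuadratic`): at a place with
  `[K_w : ℚ_v] = 2`, `w ∤ 2`, `E(K_w)[2] = 0` — e.g. a ramified `p ∣ d_K` of good reduction with `a_p(E)` odd —
  a class over `ℚ` descending a `K`-Selmer class is Selmer at `p`: the `d_K`-relaxed local condition of the
  (+)-descent (critic #179) is EMPTY there.

References: [Matsuno2009] §3 (W_{v,K}); [Kramer1981] §2 Prop. 3, §3; [SerreGaloisCohomology1997] I.§2.4, II.§1.1.
-/

set_option autoImplicit false
-- the Theorems namespace of this sub repeats the summit name by design (D-0017 nested layout)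
set_option linter.dupNamespace false

noncomputable section

open scoped Classical

namespace Summit.BirchSwinnertonDyer.BirchSwinnertonDyer.Theorems.GenusExact.PlusDescent

open WeierstrassCurve NumberField IsDedekindDomain Literature.NumberTheory.EllipticCurves
  Literature.Barriers.BirchSwinnertonDyer

variable (E : WeierstrassCurve ℚ) (K : Type) [Field K] [NumberField K] (v : HeightOneSpectrum (𝓞 ℚ))
  (w : HeightOneSpectrum (𝓞 K)) [w.asIdeal.LiesOver v.asIdeal]

/-- **`W_{v,K} = 0` ⟹ the `K_w`-local and `ℚ_v`-local conditions on `H¹(ℚ, E)` coincide.** For `E/ℚ`, a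
number field `K` and finite places `w ∣ v`: if Matsuno's `W_{v,K} = ker(H¹(ℚ_v, E) → H¹(K_w, E))` vanishes
then a class of `H¹(ℚ, E)` dies in `H¹(K_w, E)` iff it dies in `H¹(ℚ_v, E)` (`⊇` is the tower
`ℚ → ℚ_v → K_w`, `localRestrictionKer_le_of_tower`; `⊆`: its image in `H¹(ℚ_v, E)` lies in `W_{v,K}`,
`mem_localRestrictionKer_iff_resBaseChange_mem`). [cite: Matsuno2009, §3 (p. 451, W_{v,K})]
[cite: SerreGaloisCohomology1997, I.§2.4 and II.§1.1] -/
theorem localRestrictionKer_adicCompletion_eq_of_localKernel_eq_bot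
    (hW : Matsuno2009.localKernel E K v w = ⊥) :
    E.localRestrictionKer (w.adicCompletion K) = E.localRestrictionKer (v.adicCompletion ℚ) := by
  letI : Algebra (v.adicCompletion ℚ) (w.adicCompletion K) :=
    (Literature.NumberTheory.EllipticCurves.adicCompletionMap (K := ℚ) K v w).toAlgebra
  haveI : IsScalarTower ℚ (v.adicCompletion ℚ) (w.adicCompletion K) :=
    IsScalarTower.of_algebraMap_eq fun x ↦
      (Literature.NumberTheory.EllipticCurves.adicCompletionMap_coe (K := ℚ) K v w x).symm
  refine le_antisymm (fun c hc ↦ ?_) (localRestrictionKer_le_of_tower E)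
  have h := (mem_localRestrictionKer_iff_resBaseChange_mem E (L := v.adicCompletion ℚ)
    (E' := w.adicCompletion K) c).mp hc
  change resBaseChange E (v.adicCompletion ℚ) c ∈ Matsuno2009.localKernel E K v w at h
  rw [hW, AddSubgroup.mem_bot] at h
  exact (mem_ker_resBaseChange_iff E (v.adicCompletion ℚ) c).mp h

/-- **Read on `res_K c`**: if `W_{v,K} = 0` and the restriction `res_K c ∈ H¹(K, E_K)` of `c ∈ H¹(ℚ, E)` is
locally trivial at `w`, then `c` is locally trivial at `v` (`mem_localRestrictionKer_iff_resBaseChange_mem` with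
`localRestrictionKer_adicCompletion_eq_of_localKernel_eq_bot`). [cite: Matsuno2009, §3 (p. 451, W_{v,K})] -/
theorem mem_localRestrictionKer_adicCompletion_of_resBaseChange_mem
    (hW : Matsuno2009.localKernel E K v w = ⊥) (c : E.galH1)
    (hc : resBaseChange E K c ∈ (E.baseChange K).localRestrictionKer (w.adicCompletion K)) :
    c ∈ E.localRestrictionKer (v.adicCompletion ℚ) := by
  haveI : IsScalarTower ℚ K (w.adicCompletion K) := IsScalarTower.of_algebraMap_eq fun x ↦
    (IsScalarTower.algebraMap_apply ℚ K (w.adicCompletion K) x)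
  rw [← localRestrictionKer_adicCompletion_eq_of_localKernel_eq_bot E K v w hW]
  exact (mem_localRestrictionKer_iff_resBaseChange_mem E (L := K) (E' := w.adicCompletion K) c).mpr hc

/-- **Level `n`: `W_{v,K} = 0` ⟹ the Selmer condition at `w` (read in `H¹(K_w, E)`) for a class of
`H¹(ℚ, E[n])` IS the Selmer condition at `v`** (`selmerLocalKer` is the preimage of `localRestrictionKer` under
`H¹(ℚ, E[n]) → H¹(ℚ, E)`, `mem_selmerLocalKer_iff_torsionH1ToH1_mem`). [cite: Matsuno2009, §3 (p. 451, W_{v,K})]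
[cite: SilvermanAEC2009, X.§4 (local conditions)] -/
theorem selmerLocalKer_adicCompletion_eq_of_localKernel_eq_bot
    (hW : Matsuno2009.localKernel E K v w = ⊥) (n : ℤ) :
    selmerLocalKer E (w.adicCompletion K) n = selmerLocalKer E (v.adicCompletion ℚ) n := by
  ext c
  rw [WeierstrassCurve.mem_selmerLocalKer_iff_torsionH1ToH1_mem,
    WeierstrassCurve.mem_selmerLocalKer_iff_torsionH1ToH1_mem,
    localRestrictionKer_adicCompletion_eq_of_localKernel_eq_bot E K v w hW]

/-- **THE `d_K`-RELAXATION IS EMPTY AT A QUADRATIC PLACE WITHOUT LOCAL `2`-TORSION** (critic #179 price (1),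
`a_p`-odd case): for `E/ℚ` elliptic, `w ∣ v` finite with `[K_w : ℚ_v] = 2`, `w ∤ 2` and `E(K_w)[2] = 0`, and
every level `n`, the Selmer condition at `w` of a class of `H¹(ℚ, E[n])` coincides with its Selmer condition at
`v` — `localKernel_eq_bot_of_finrank_eq_two_of_forall_two_smul` (`W_{v,K} = 0`) with
`selmerLocalKer_adicCompletion_eq_of_localKernel_eq_bot`.  For the Heegner field `K` and a ramified odd prime
`p ∣ d_K` (good reduction) this is the case `Ẽ(𝔽_p)[2] = 0`, i.e. `a_p(E)` odd (Kramer 1981 Prop. 3).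
[cite: Kramer1981, §2 Prop. 3] [cite: Matsuno2009, §3 (p. 451, W_{v,K})] -/
theorem selmerLocalKer_adicCompletion_eq_of_finrank_eq_two_of_forall_two_smul [E.IsElliptic]
    (h2 : letI : Algebra (v.adicCompletion ℚ) (w.adicCompletion K) :=
        (Literature.NumberTheory.EllipticCurves.adicCompletionMap (K := ℚ) K v w).toAlgebra
      Module.finrank (v.adicCompletion ℚ) (w.adicCompletion K) = 2)
    (hw : ((2 : ℕ) : 𝓞 K) ∉ w.asIdeal)
    (htors : ∀ P : ((E.baseChange K).baseChange (w.adicCompletion K)).toAffine.Point, 2 • P = 0 → P = 0)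
    (n : ℤ) :
    selmerLocalKer E (w.adicCompletion K) n = selmerLocalKer E (v.adicCompletion ℚ) n :=
  selmerLocalKer_adicCompletion_eq_of_localKernel_eq_bot E K v w
    (localKernel_eq_bot_of_finrank_eq_two_of_forall_two_smul E K v w h2 hw htors) n

end Summit.BirchSwinnertonDyer.BirchSwinnertonDyer.Theorems.GenusExact.PlusDescent

end
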